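import Literature.Analysis.FluidPDE.TaylorGreenVortex
import Mathlib.Analysis.Calculus.IteratedDeriv.Lemmas
import Mathlib.Analysis.SpecialFunctions.Trigonometric.Deriv
import HarnessLib

/-!
# Barrier support: FREQUENCY DOUBLING by the quadratic term on the Taylor–Green datum —
# all pure derivatives of the datum are bounded by `1`, those of `((u·∇)u)₁` grow like `2^m`

Barrier catalogue support file for `NavierStokesRegularity` (D-0021), METHOD LEVEL, everything
PROVED (Mathlib calculus + the tree's Taylor–Green file
`Literature.Analysis.FluidPDE.TaylorGreenVortex`). It is the physical-side half of the entry
`BandLimitedClassNotInvariant` (the Fourier-side half: uniformly bounded pure derivatives of all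
orders ⇔ band-limitation, Paley–Wiener/Bernstein).

A recurring scheme (cell `ns-claims`, row C26: Han, arXiv:1307.1012v1, withdrawn v2 «crucial
error in Section 2») controls a solution of Navier–Stokes, or of the forced Stokes problem, in the
«`H^∞` max-norm» `‖u‖ := max_{m ≥ 0} Σ_j ‖∂_j^m u‖` — ALL pure derivatives UNIFORMLY bounded —
and runs the same norm on the convective quantity `(u·∇)u`, closing by Gronwall
[cite: Han2013, Lemma 2.1 (EnEs-LNS3) and Lemma 4.1, TeX l.435–470 / l.831–845]. Finiteness of
such a norm forces the Fourier support into the unit frequency cube, and PRODUCTS DOUBLE THE BAND.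
This file records the doubling on the tree's explicit divergence-free datum, the Taylor–Green
vortex `u = (sin x cos y cos z, −cos x sin y cos z, 0)` [cite: TaylorGreen1937, eq. (12)], whose
nonlinearity is `(u·∇)u = (½ sin 2x cos² z, ½ sin 2y cos² z, 0)` (tree
`TaylorGreenVortex.convect_velocity`) [cite: TaylorGreen1937, eqs. (14)–(15)]:

* `abs_dirDeriv_velocity_le_one`: every pure derivative of every order of every component of the
  datum is bounded by `1` pointwise: `|∂_j^m u_i(x)| ≤ 1` — so every «sup over all orders»
  functional built from sup norms (or from `L²` norms over a period cell) is FINITE on `u`;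
* `abs_dirDeriv_convect_eq`: `∂₁^m ((u·∇)u)₁` attains the value `2^m/2` in absolute value
  (at `z = 0`, `x = π/4` for even `m`, `x = 0` for odd `m`), hence
  `not_bddAbove_dirDeriv_convect`: `sup_{m,x} |∂₁^m ((u·∇)u)₁(x)| = ∞` — the same functional is
  INFINITE on `(u·∇)u`: the quadratic term has left the band (`|k_j| ≤ 1` ↦ `|k₁| = 2`), and so
  has its divergence-free part (tree `TaylorGreenVortex.convect_add_gradient_pressure`: modes
  `sin 2x cos 2z`, …), i.e. `∂ₜu(0)` itself (`TaylorGreenVortex.initialAcceleration_eq`).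

Directional iterated derivatives are Mathlib's `iteratedFDeriv ℝ m f x (fun _ => eⱼ)` (the cell's
`pdPow` of the C26 skeleton); `iteratedFDeriv_const_eq_iteratedDeriv` identifies them with the
one-variable iterated derivative of `t ↦ f(x + t eⱼ)`, after which everything is `sin`/`cos`
calculus (`iteratedDeriv_even_sin`, `iteratedDeriv_comp_const_mul`, …).

## References

* G. I. Taylor, A. E. Green, Proc. R. Soc. A 158 (1937) 499–521, eqs. (12)–(15). [`TaylorGreen1937`]
* Y. Han, arXiv:1307.1012v1 (2013), withdrawn; Lemma 2.1 / Lemma 4.1 (the max-norm scheme). [`Han2013`]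
* C. Foias, R. Temam, J. Funct. Anal. 87 (1989) 359–369 (the honest, time-dependent analyticity radius). [`FoiasTemam1989`]

WHAT THIS IS NOT: not a claim about NS regularity or blow-up; not a claim about any author beyond
the typed locator.
-/

noncomputable section

open Real Set Function
open scoped ContDiff Topology

namespace Literature.Barriers.NavierStokesRegularity

namespace BandLimited

open Literature.Analysis.FluidPDE Literature.Analysis.FluidPDE.TaylorGreenVortex

/-! ## Directional iterated derivatives are one-variable iterated derivatives -/

/-- **`D^m f(x)[v,…,v] = (d/dt)^m f(x + t v)|_{t=0}`** for a smooth `f` on a real normed space: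
the `m`-fold Fréchet derivative evaluated on the constant family `v` is the `m`-th derivative of the
restriction to the line `t ↦ x + t v` (chain rule with the linear map `t ↦ t v` and translation
invariance of `iteratedFDeriv`). [folklore] -/
private theorem iteratedFDeriv_const_eq_iteratedDeriv {E F : Type*} [NormedAddCommGroup E] [NormedSpace ℝ E]
    [NormedAddCommGroup F] [NormedSpace ℝ F] {f : E → F} (hf : ContDiff ℝ ∞ f) (x v : E) (m : ℕ) :
    iteratedFDeriv ℝ m f x (fun _ => v) = iteratedDeriv m (fun t : ℝ => f (x + t • v)) 0 := by
  set g : ℝ →L[ℝ] E := ContinuousLinearMap.toSpanSingleton ℝ v with hg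
  have hshift : ContDiff ℝ ∞ (fun y : E => f (x + y)) := hf.comp (contDiff_const.add contDiff_id)
  have hcomp : (fun t : ℝ => f (x + t • v)) = (fun y : E => f (x + y)) ∘ g := by
    funext t
    simp [hg, ContinuousLinearMap.toSpanSingleton_apply]
  rw [iteratedDeriv_eq_iteratedFDeriv, hcomp,
    ContinuousLinearMap.iteratedFDeriv_comp_right g hshift 0 (by exact_mod_cast le_top),
    ContinuousMultilinearMap.compContinuousLinearMap_apply]
  have h0 : g 0 = 0 := by simp [hg]
  have h1 : (fun _ : Fin m => g 1) = fun _ => v := by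
    funext i
    simp [hg, ContinuousLinearMap.toSpanSingleton_apply]
  simp only [h1, h0]
  rw [iteratedFDeriv_comp_add_left, add_zero]

/-! ## One-variable trigonometric bookkeeping -/

/-- `|sin^{(m)}(y)| ≤ 1`. [folklore] -/
private theorem abs_iteratedDeriv_sin_le (m : ℕ) (y : ℝ) : |iteratedDeriv m Real.sin y| ≤ 1 := by
  obtain ⟨k, rfl | rfl⟩ := Nat.even_or_odd' m
  · rw [Real.iteratedDeriv_even_sin]
    simp only [Pi.mul_apply, Pi.pow_apply, Pi.neg_apply, Pi.one_apply, abs_mul, abs_pow, abs_neg,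
      abs_one, one_pow, one_mul]
    exact Real.abs_sin_le_one y
  · rw [Real.iteratedDeriv_odd_sin]
    simp only [Pi.mul_apply, Pi.pow_apply, Pi.neg_apply, Pi.one_apply, abs_mul, abs_pow, abs_neg,
      abs_one, one_pow, one_mul]
    exact Real.abs_cos_le_one y

/-- `|cos^{(m)}(y)| ≤ 1`. [folklore] -/
private theorem abs_iteratedDeriv_cos_le (m : ℕ) (y : ℝ) : |iteratedDeriv m Real.cos y| ≤ 1 := by
  obtain ⟨k, rfl | rfl⟩ := Nat.even_or_odd' m
  · rw [Real.iteratedDeriv_even_cos]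
    simp only [Pi.mul_apply, Pi.pow_apply, Pi.neg_apply, Pi.one_apply, abs_mul, abs_pow, abs_neg,
      abs_one, one_pow, one_mul]
    exact Real.abs_cos_le_one y
  · rw [Real.iteratedDeriv_odd_cos]
    simp only [Pi.mul_apply, Pi.pow_apply, Pi.neg_apply, Pi.one_apply, abs_mul, abs_pow, abs_neg,
      abs_one, one_pow, one_mul]
    exact Real.abs_sin_le_one y

/-- For a smooth `g` and constants `c, a`: `(d/dt)^m [c · g(a + t)] (0) = c · g^{(m)}(a)`. [folklore] -/
private theorem iteratedDeriv_const_mul_comp_add {g : ℝ → ℝ} (hg : ContDiff ℝ ∞ g) (c a : ℝ) (m : ℕ) :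
    iteratedDeriv m (fun t : ℝ => c * g (a + t)) 0 = c * iteratedDeriv m g a := by
  have hga : ContDiff ℝ ∞ (fun t : ℝ => g (a + t)) := hg.comp (contDiff_const.add contDiff_id)
  rw [iteratedDeriv_const_mul c (hga.contDiffAt.of_le (by exact_mod_cast le_top))]
  have := congrFun (iteratedDeriv_comp_const_add m g a) 0
  simp only [add_zero] at this
  rw [this]

/-- If `|c| ≤ 1` and `g ∈ {sin, cos}`-like (`|g^{(m)}| ≤ 1`), then `|(d/dt)^m [c · g(a + t)](0)| ≤ 1`. [folklore] -/
private theorem abs_iteratedDeriv_const_mul_comp_add_le {g : ℝ → ℝ} (hg : ContDiff ℝ ∞ g)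
    (hg1 : ∀ m y, |iteratedDeriv m g y| ≤ 1) {c : ℝ} (hc : |c| ≤ 1) (a : ℝ) (m : ℕ) :
    |iteratedDeriv m (fun t : ℝ => c * g (a + t)) 0| ≤ 1 := by
  rw [iteratedDeriv_const_mul_comp_add hg, abs_mul]
  calc |c| * |iteratedDeriv m g a| ≤ 1 * 1 :=
        mul_le_mul hc (hg1 m a) (abs_nonneg _) zero_le_one
    _ = 1 := one_mul _

/-- `|cos a · cos b| ≤ 1` and its relatives: a product of two numbers of absolute value `≤ 1`. [folklore] -/
private theorem abs_mul_le_one_of {p q : ℝ} (hp : |p| ≤ 1) (hq : |q| ≤ 1) : |p * q| ≤ 1 := by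
  rw [abs_mul]
  calc |p| * |q| ≤ 1 * 1 := mul_le_mul hp hq (abs_nonneg _) zero_le_one
    _ = 1 := one_mul _

/-! ## The datum: every pure derivative bounded by one -/

/-- Component `0` of the datum, `sin x₀ cos x₁ cos x₂`: `|∂ⱼ^m u₀(x)| ≤ 1`. [cite: TaylorGreen1937, eq. (12)] -/
theorem abs_dirDeriv_velocity_zero_le_one (m : ℕ) (j : Fin 3) (x : EuclideanSpace ℝ (Fin 3)) :
    |iteratedFDeriv ℝ m (fun y : EuclideanSpace ℝ (Fin 3) => velocity y 0) x (fun _ => EuclideanSpace.single j (1 : ℝ))| ≤ 1 := by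
  have hsm : ContDiff ℝ ∞ (fun y : EuclideanSpace ℝ (Fin 3) => velocity y 0) :=
    (contDiff_euclidean.1 (contDiff_velocity (n := ∞))) 0
  rw [iteratedFDeriv_const_eq_iteratedDeriv hsm]
  fin_cases j
  · have h : (fun t : ℝ => velocity (x + t • (EuclideanSpace.single (0 : Fin 3) (1 : ℝ))) 0) =
        fun t => (cos (x 1) * cos (x 2)) * Real.sin (x 0 + t) := by
      funext t; simp [velocity]; ring
    simpa [h] using abs_iteratedDeriv_const_mul_comp_add_le Real.contDiff_sin abs_iteratedDeriv_sin_le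
      (abs_mul_le_one_of (abs_cos_le_one _) (abs_cos_le_one _)) (x 0) m
  · have h : (fun t : ℝ => velocity (x + t • (EuclideanSpace.single (1 : Fin 3) (1 : ℝ))) 0) =
        fun t => (sin (x 0) * cos (x 2)) * Real.cos (x 1 + t) := by
      funext t; simp [velocity]; ring
    simpa [h] using abs_iteratedDeriv_const_mul_comp_add_le Real.contDiff_cos abs_iteratedDeriv_cos_le
      (abs_mul_le_one_of (abs_sin_le_one _) (abs_cos_le_one _)) (x 1) m
  · have h : (fun t : ℝ => velocity (x + t • (EuclideanSpace.single (2 : Fin 3) (1 : ℝ))) 0) =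
        fun t => (sin (x 0) * cos (x 1)) * Real.cos (x 2 + t) := by
      funext t; simp [velocity]
    simpa [h] using abs_iteratedDeriv_const_mul_comp_add_le Real.contDiff_cos abs_iteratedDeriv_cos_le
      (abs_mul_le_one_of (abs_sin_le_one _) (abs_cos_le_one _)) (x 2) m

/-- Component `1` of the datum, `−cos x₀ sin x₁ cos x₂`: `|∂ⱼ^m u₁(x)| ≤ 1`. [cite: TaylorGreen1937, eq. (12)] -/
theorem abs_dirDeriv_velocity_one_le_one (m : ℕ) (j : Fin 3) (x : EuclideanSpace ℝ (Fin 3)) :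
    |iteratedFDeriv ℝ m (fun y : EuclideanSpace ℝ (Fin 3) => velocity y 1) x (fun _ => EuclideanSpace.single j (1 : ℝ))| ≤ 1 := by
  have hsm : ContDiff ℝ ∞ (fun y : EuclideanSpace ℝ (Fin 3) => velocity y 1) :=
    (contDiff_euclidean.1 (contDiff_velocity (n := ∞))) 1
  rw [iteratedFDeriv_const_eq_iteratedDeriv hsm]
  fin_cases j
  · have h : (fun t : ℝ => velocity (x + t • (EuclideanSpace.single (0 : Fin 3) (1 : ℝ))) 1) =
        fun t => (-(sin (x 1) * cos (x 2))) * Real.cos (x 0 + t) := by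
      funext t; simp [velocity]; ring
    have hc : |(-(sin (x 1) * cos (x 2)))| ≤ 1 := by
      rw [abs_neg]; exact abs_mul_le_one_of (abs_sin_le_one _) (abs_cos_le_one _)
    simpa [h] using abs_iteratedDeriv_const_mul_comp_add_le Real.contDiff_cos abs_iteratedDeriv_cos_le hc (x 0) m
  · have h : (fun t : ℝ => velocity (x + t • (EuclideanSpace.single (1 : Fin 3) (1 : ℝ))) 1) =
        fun t => (-(cos (x 0) * cos (x 2))) * Real.sin (x 1 + t) := by
      funext t; simp [velocity]; ring
    have hc : |(-(cos (x 0) * cos (x 2)))| ≤ 1 := by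
      rw [abs_neg]; exact abs_mul_le_one_of (abs_cos_le_one _) (abs_cos_le_one _)
    simpa [h] using abs_iteratedDeriv_const_mul_comp_add_le Real.contDiff_sin abs_iteratedDeriv_sin_le hc (x 1) m
  · have h : (fun t : ℝ => velocity (x + t • (EuclideanSpace.single (2 : Fin 3) (1 : ℝ))) 1) =
        fun t => (-(cos (x 0) * sin (x 1))) * Real.cos (x 2 + t) := by
      funext t; simp [velocity]
    have hc : |(-(cos (x 0) * sin (x 1)))| ≤ 1 := by
      rw [abs_neg]; exact abs_mul_le_one_of (abs_cos_le_one _) (abs_sin_le_one _)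
    simpa [h] using abs_iteratedDeriv_const_mul_comp_add_le Real.contDiff_cos abs_iteratedDeriv_cos_le hc (x 2) m

/-- Component `2` of the datum vanishes identically, so do all its derivatives. [cite: TaylorGreen1937, eq. (12)] -/
theorem abs_dirDeriv_velocity_two_le_one (m : ℕ) (j : Fin 3) (x : EuclideanSpace ℝ (Fin 3)) :
    |iteratedFDeriv ℝ m (fun y : EuclideanSpace ℝ (Fin 3) => velocity y 2) x (fun _ => EuclideanSpace.single j (1 : ℝ))| ≤ 1 := by
  have h : (fun y : EuclideanSpace ℝ (Fin 3) => velocity y 2) = fun _ => (0 : ℝ) := by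
    funext y; simp [velocity]
  rw [h, iteratedFDeriv_fun_zero]
  simp

/-- **All pure derivatives of all orders of the Taylor–Green datum are bounded by `1`:**
`|∂ⱼ^m uᵢ(x)| ≤ 1` for all `m ≥ 0`, directions `j`, components `i`, points `x`. (Each component is a
product of three unit-frequency trigonometric factors, exactly one of which depends on `xⱼ`.)
Hence `sup_m Σ_j sup_x |∂ⱼ^m u| ≤ 3 < ∞`: the datum lies in every «sup over all orders» class —
its Fourier modes sit on `|k_j| ≤ 1` (tree: `TaylorGreenVortex.laplacian_velocity`, `Δu = −3u`).
[cite: TaylorGreen1937, eq. (12)] -/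
theorem abs_dirDeriv_velocity_le_one (m : ℕ) (j i : Fin 3) (x : EuclideanSpace ℝ (Fin 3)) :
    |iteratedFDeriv ℝ m (fun y : EuclideanSpace ℝ (Fin 3) => velocity y i) x (fun _ => EuclideanSpace.single j (1 : ℝ))| ≤ 1 := by
  fin_cases i
  · exact abs_dirDeriv_velocity_zero_le_one m j x
  · exact abs_dirDeriv_velocity_one_le_one m j x
  · exact abs_dirDeriv_velocity_two_le_one m j x

/-! ## The nonlinearity: pure derivatives grow like `2^m` -/

/-- The first component of `(u·∇)u` along the line `x + t e₁`:
`½ sin(2(x₀ + t)) cos² x₂ = (½ cos² x₂) · sin(2x₀ + 2t)`. [cite: TaylorGreen1937, eqs. (14)–(15)] -/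
private theorem convectField_line_zero (x : EuclideanSpace ℝ (Fin 3)) :
    (fun t : ℝ => convectField (x + t • (EuclideanSpace.single (0 : Fin 3) (1 : ℝ))) 0) =
      fun t => (1 / 2 * cos (x 2) ^ 2) * (fun s => Real.sin (2 * x 0 + s)) (2 * t) := by
  funext t
  simp [convectField]
  ring_nf

/-- **`∂₁^m ((u·∇)u)₁ (x) = 2^m · ½ cos² x₂ · sin^{(m)}(2x₀)`** — each derivative in `x₁` brings a
factor `2`: the nonlinearity lives on the DOUBLED frequency `|k₁| = 2`.
[cite: TaylorGreen1937, eqs. (14)–(15)] -/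
theorem dirDeriv_convect_zero (m : ℕ) (x : EuclideanSpace ℝ (Fin 3)) :
    iteratedFDeriv ℝ m (fun y : EuclideanSpace ℝ (Fin 3) => convectField y 0) x (fun _ => EuclideanSpace.single (0 : Fin 3) (1 : ℝ)) =
      2 ^ m * (1 / 2 * cos (x 2) ^ 2 * iteratedDeriv m Real.sin (2 * x 0)) := by
  have hsm : ContDiff ℝ ∞ (fun y : EuclideanSpace ℝ (Fin 3) => convectField y 0) := by
    have := (contDiff_euclidean.1 (contDiff_velocity (n := ∞)))
    -- `convectField` is smooth: it is an explicit trigonometric polynomial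
    have hc : ∀ j : Fin 3, ContDiff ℝ ∞ (fun y : EuclideanSpace ℝ (Fin 3) => y j) := fun j =>
      (EuclideanSpace.proj j : EuclideanSpace ℝ (Fin 3) →L[ℝ] ℝ).contDiff
    have h : (fun y : EuclideanSpace ℝ (Fin 3) => convectField y 0) = fun y => 1 / 2 * Real.sin (2 * y 0) * Real.cos (y 2) ^ 2 := by
      funext y; simp [convectField]
    rw [h]
    exact (contDiff_const.mul ((contDiff_const.mul (hc 0)).sin)).mul ((hc 2).cos.pow 2)
  rw [iteratedFDeriv_const_eq_iteratedDeriv hsm, convectField_line_zero]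
  have hg : ContDiff ℝ ∞ (fun s : ℝ => Real.sin (2 * x 0 + s)) :=
    Real.contDiff_sin.comp (contDiff_const.add contDiff_id)
  have hg2 : ContDiff ℝ ∞ (fun t : ℝ => (fun s : ℝ => Real.sin (2 * x 0 + s)) (2 * t)) :=
    hg.comp (contDiff_const.mul contDiff_id)
  rw [iteratedDeriv_const_mul _ (hg2.contDiffAt.of_le (by exact_mod_cast le_top))]
  have hscale := congrFun (iteratedDeriv_comp_const_mul (n := m) (hg.of_le (by exact_mod_cast le_top)) (2 : ℝ)) 0
  simp only [mul_zero] at hscale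
  rw [hscale]
  have hshift := congrFun (iteratedDeriv_comp_const_add m Real.sin (2 * x 0)) 0
  simp only [add_zero] at hshift
  rw [hshift]
  ring

/-- **The value `2^m / 2` is attained:** for every `m` there is a point `x` (with `x₂ = 0`, and
`x₀ = π/4` for even `m`, `x₀ = 0` for odd `m`) with `|∂₁^m ((u·∇)u)₁ (x)| = 2^m / 2`.
[cite: TaylorGreen1937, eqs. (14)–(15)] -/
theorem abs_dirDeriv_convect_eq (m : ℕ) :
    ∃ x : EuclideanSpace ℝ (Fin 3), |iteratedFDeriv ℝ m (fun y : EuclideanSpace ℝ (Fin 3) => convectField y 0) x (fun _ => EuclideanSpace.single (0 : Fin 3) (1 : ℝ))| = 2 ^ m / 2 := by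
  obtain ⟨k, rfl | rfl⟩ := Nat.even_or_odd' m
  · refine ⟨(π / 4) • (EuclideanSpace.single (0 : Fin 3) (1 : ℝ)), ?_⟩
    have h0 : ((π / 4) • (EuclideanSpace.single (0 : Fin 3) (1 : ℝ)) : EuclideanSpace ℝ (Fin 3)) 0 = π / 4 := by simp
    have h2 : ((π / 4) • (EuclideanSpace.single (0 : Fin 3) (1 : ℝ)) : EuclideanSpace ℝ (Fin 3)) 2 = 0 := by simp
    have hval : iteratedFDeriv ℝ (2 * k) (fun y : EuclideanSpace ℝ (Fin 3) => convectField y 0) ((π / 4) • (EuclideanSpace.single (0 : Fin 3) (1 : ℝ)))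
        (fun _ => EuclideanSpace.single (0 : Fin 3) (1 : ℝ)) = 2 ^ (2 * k) * (1 / 2 * (-1) ^ k) := by
      rw [dirDeriv_convect_zero, Real.iteratedDeriv_even_sin, h0, h2,
        show 2 * (π / 4) = π / 2 by ring]
      simp [Real.sin_pi_div_two]
    rw [hval, abs_mul, abs_mul, abs_pow, abs_pow, abs_neg, abs_one, one_pow, mul_one, abs_two,
      abs_of_pos (by norm_num : (0:ℝ) < 1 / 2)]
    ring
  · refine ⟨0, ?_⟩
    have hval : iteratedFDeriv ℝ (2 * k + 1) (fun y : EuclideanSpace ℝ (Fin 3) => convectField y 0) 0 (fun _ => EuclideanSpace.single (0 : Fin 3) (1 : ℝ)) =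
        2 ^ (2 * k + 1) * (1 / 2 * (-1) ^ k) := by
      rw [dirDeriv_convect_zero, Real.iteratedDeriv_odd_sin]
      simp
    rw [hval, abs_mul, abs_mul, abs_pow, abs_pow, abs_neg, abs_one, one_pow, mul_one, abs_two,
      abs_of_pos (by norm_num : (0:ℝ) < 1 / 2)]
    ring

/-- **BARRIER support (physical side): the «sup over all orders» functional is infinite on the
nonlinearity of a datum on which it is finite.** `{ |∂₁^m ((u·∇)u)₁ (x)| : m, x }` is not bounded
above (it contains `2^m/2` for every `m`), while `|∂ⱼ^m uᵢ| ≤ 1` throughout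
(`abs_dirDeriv_velocity_le_one`). So the map `u ↦ (u·∇)u` does not send the class
`{sup_m Σ_j ‖∂ⱼ^m ·‖ < ∞}` (sup norms here; `L²` over a period cell differs by fixed constants) into
itself, and no estimate `‖(u·∇)u‖ ≤ G(‖u‖, data)` in such a norm can hold along a flow that is not
frequency-localised — the Gronwall step of [cite: Han2013, proof of Lemma 2.1, sentence after (2.21), TeX l.575–578]
is applied to a quantity that is `+∞` (kernel: `Summit.….Theorems.Han2013.not_Step_L21G`, p478733).
[cite: TaylorGreen1937, eqs. (14)–(15)] -/
theorem not_bddAbove_dirDeriv_convect :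
    ¬ BddAbove (Set.range fun p : ℕ × EuclideanSpace ℝ (Fin 3) =>
        |iteratedFDeriv ℝ p.1 (fun y : EuclideanSpace ℝ (Fin 3) => convectField y 0) p.2 (fun _ => EuclideanSpace.single (0 : Fin 3) (1 : ℝ))|) := by
  rintro ⟨K, hK⟩
  -- pick `m` with `2^m / 2 > K`
  obtain ⟨m, hm⟩ : ∃ m : ℕ, K < 2 ^ m / 2 := by
    obtain ⟨m, hm⟩ := pow_unbounded_of_one_lt (2 * K) (by norm_num : (1 : ℝ) < 2)
    exact ⟨m, by linarith⟩
  obtain ⟨x, hx⟩ := abs_dirDeriv_convect_eq m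
  have hle : |iteratedFDeriv ℝ m (fun y : EuclideanSpace ℝ (Fin 3) => convectField y 0) x (fun _ => EuclideanSpace.single (0 : Fin 3) (1 : ℝ))| ≤ K :=
    hK ⟨(m, x), rfl⟩
  rw [hx] at hle
  linarith

/-- The same statement on the tree's `convect velocity velocity` (`= convectField`,
`TaylorGreenVortex.convect_velocity`): the convective term OF THE TAYLOR–GREEN DATUM has unbounded
pure `x₁`-derivatives of its first component. [cite: TaylorGreen1937, eqs. (14)–(15)] -/
theorem not_bddAbove_dirDeriv_convect_velocity :
    ¬ BddAbove (Set.range fun p : ℕ × EuclideanSpace ℝ (Fin 3) =>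
        |iteratedFDeriv ℝ p.1 (fun y : EuclideanSpace ℝ (Fin 3) => convect velocity velocity y 0) p.2 (fun _ => EuclideanSpace.single (0 : Fin 3) (1 : ℝ))|) := by
  have h : (fun y : EuclideanSpace ℝ (Fin 3) => convect velocity velocity y 0) = fun y => convectField y 0 := by
    funext y; rw [convect_velocity]
  rw [h]
  exact not_bddAbove_dirDeriv_convect

end BandLimited

end Literature.Barriers.NavierStokesRegularity
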